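import Literature.MathematicalPhysics.QuantumFieldTheory.Balaban1983to89.B9B8KnitLetterRegular

/-!
# `Balaban1983to89.B9B8AveragedBondsStraight` — [B7]'s AVERAGED BOND VARIABLES ARE CLOSE TO THE STRAIGHT TRANSPORTERS of the fine field:
# `|Ū^j(x, x + e_κ) − U(Γ_{Lʲx, Lʲx + Lʲe_κ})| ≤ 16(d+1)α₀(Lʲη)²` on the class (52), uniformly in `j ≤ k` (file 5a of the coercivity transfer at
# the knit letter, junction J-B)

statement-level skeleton of published theorems with citation tags; proofs where landed; nothing here is a claim about the
Yang–Mills mass gap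

T. Bałaban, *Averaging operations for lattice gauge theories*, Commun. Math. Phys. **98** (1985) 17–51 [`Balaban1985Averaging`, "[B7]"]; T. Bałaban,
*Propagators for lattice gauge theories in a background field*, Commun. Math. Phys. **99** (1985) 389–434 [`Balaban1985BackgroundPropagators`, "[B9]"].

THE PRINT.  [B7] p. 25 (between (44) and (47)): *«|V₀(Γ_{c,x}) − 1| < |Γ_{c,x}|dLα₀ < (2d+1)LdLα₀ = O(1)L²α₀»*, (42) p. 23 *«V̄_c = exp[…]V(c)»*, Prop. 2
(52)–(54) p. 26 (*«|Ū^j(∂p) − 1| < … < 2α₀»* uniformly in `j`); [B9] (3.19) p. 393 (the composite contours `Γ^{(j)}_{y,x}` of the averaging operators are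
built from these bonds).  The statement proved here — the averaged bond is within `O(1)α₀(Lʲη)²·…` of the straight fine transporter — is the cell's
bookkeeping consequence of (42) + (53) (the exponent `X_c` is `O(L²·pdev)`, `B8Lemma1NonAbelian.norm_Xavg_le`), used by junction J-B to compare the
[B8]-knit's transporters with def-Y's taxicab ones; it is NOT a numbered display of [B7].

CITATION HEADER (lean-in-tree rule).  Cell `lit-balaban`, sub-row G-B9-LETTERS, junction J-B (lead RULINGS #3–#4) file 5a → seat `lit-balaban-p33` gen 91.
REUSED BY NAME: `B7Prop1Explicit` (words, `hol`, `seg`, `U1`, `bavg`, `Xavg`, `expUnit`), `B7Prop2Explicit` (`avgIter`, `pdev`, `le_pdev`, `avgIter_mem`,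
`prop2_explicit_lt_two`, `AvgClosed`, `C0`, `c2'`), `B8Lemma1NonAbelian` (`PlaqSmall`, `pairTop`, `omegaC`, `norm_Xavg_le`), `B7Transfer.norm_exp_sub_one_le_of_le`.

WHAT THIS FILE PROVES (sorry-free; one definition with body — the scaled word `scaleWord`).
* §1 WORDS: `scaleWord n Γ` (every letter repeated `n` times: the level-`j` contour read on the fine lattice, `n = Lʲ`), its displacement, and ★ the
  TELESCOPING COMPARISON `‖W(Γ) − V(scaleWord n Γ)‖ ≤ |Γ|·ε` whenever every bond of `W` is within `ε` of the straight `n`-step transporter of `V`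
  (`hol_scaleWord_approx`; `U1`-valued fields).
* §2 ★ ONE AVERAGE: `‖V̄_c − V(Γ_c)‖ ≤ e^{2ω} − 1`, `ω = L·a·(d−1)(L−1)` for `pdev V ≤ a`, `ω ≤ ½` (`norm_bavg_sub_hol_seg_le`).
* §3 ★★★ ALL LEVELS ON THE CLASS (52): for `G` averaging-closed, `G`-valued `V` with `pdev V < α₀(L^k)⁻²`, Prop. 2's smallness and `8DL²α₀ ≤ 1`
  (`D` the dimension): `‖Ū^j(x, x+e_κ) − V(straight Lʲ-segment from Lʲx)‖ ≤ 16·D·α₀·(Lʲ/L^k)²` for every `j ≤ k` (`avgIter_straight`).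

HONEST SCOPE.  Bookkeeping estimate with explicit constants under [B7]'s hypotheses; nothing of [B9] Thm 3.1 is proved or asserted; count-neutral; nothing
continuum, nothing about OS axioms or the mass gap.  No `sorry`, no `axiom`, no `instance`, no `notation`.  Seat `lit-balaban-p33` gen 91, 2026-08-28.
-/

noncomputable section

namespace Literature.MathematicalPhysics.QuantumFieldTheory.Balaban1983to89.B9B8AveragedBondsStraight

open B7Prop1Explicit renaming Site → LSite
open B7Prop1Explicit (e hol stepHol disp Letter seg revWord bavg Xavg expUnit U1 mem_U1 hol_mem stepHol_mem hol_cons hol_nil hol_append hol_revWord'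
  disp_cons disp_nil disp_seg disp_append stepHol_true stepHol_false seg_natCast seg_neg_natCast revWord_replicate val_expUnit)
open B7Prop2Explicit (avgIter avgIter_zero avgIter_succ rescale_apply avgIter_mem AvgClosed pdev le_pdev C0 C0_pos c2' prop2_explicit_lt_two)
open B8Lemma1NonAbelian (pairTop omegaC)
open NormedSpace

variable {D : ℕ} {𝔸 : Type*} [NormedRing 𝔸] [NormOneClass 𝔸] [NormedAlgebra ℂ 𝔸] [CompleteSpace 𝔸]

/-! ## §1 Scaled words and the telescoping comparison -/

section Words

/-- **the level-`j` contour read on the fine lattice**: every letter repeated `n = Lʲ` times. [cite: Balaban1985Averaging, (43) p.24, (52)–(53) p.27, dictionary] -/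
def scaleWord (n : ℕ) (w : List (Letter D)) : List (Letter D) := w.flatMap fun l => List.replicate n l

omit [NormedRing 𝔸] [NormOneClass 𝔸] [NormedAlgebra ℂ 𝔸] [CompleteSpace 𝔸] in
/-- unfolding on a letter. [cite: Balaban1985Averaging, (43) p.24, bookkeeping] -/
theorem scaleWord_cons (n : ℕ) (l : Letter D) (w : List (Letter D)) : scaleWord n (l :: w) = List.replicate n l ++ scaleWord n w := by
  simp [scaleWord]

omit [NormedRing 𝔸] [NormOneClass 𝔸] [NormedAlgebra ℂ 𝔸] [CompleteSpace 𝔸] in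
/-- the empty contour. [cite: Balaban1985Averaging, (43) p.24, bookkeeping] -/
@[simp] theorem scaleWord_nil (n : ℕ) : scaleWord n ([] : List (Letter D)) = [] := rfl

omit [NormedRing 𝔸] [NormOneClass 𝔸] [NormedAlgebra ℂ 𝔸] [CompleteSpace 𝔸] in
/-- scaling is multiplicative on concatenations. [cite: Balaban1985Averaging, (43) p.24, bookkeeping] -/
theorem scaleWord_append (n : ℕ) (w₁ w₂ : List (Letter D)) : scaleWord n (w₁ ++ w₂) = scaleWord n w₁ ++ scaleWord n w₂ := by
  simp [scaleWord]

omit [NormedRing 𝔸] [NormOneClass 𝔸] [NormedAlgebra ℂ 𝔸] [CompleteSpace 𝔸] in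
/-- scaling a straight segment of `m` letters gives the straight segment of `m·n` letters. [cite: Balaban1985Averaging, (43) p.24, bookkeeping] -/
theorem scaleWord_replicate (n m : ℕ) (l : Letter D) : scaleWord n (List.replicate m l) = List.replicate (m * n) l := by
  induction m with
  | zero => simp [scaleWord]
  | succ m ih => rw [List.replicate_succ, scaleWord_cons, ih, Nat.succ_mul, add_comm, List.replicate_add]

omit [NormedRing 𝔸] [NormOneClass 𝔸] [NormedAlgebra ℂ 𝔸] [CompleteSpace 𝔸] in
/-- the length scales. [cite: Balaban1985Averaging, (43) p.24, bookkeeping] -/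
theorem length_scaleWord (n : ℕ) (w : List (Letter D)) : (scaleWord n w).length = n * w.length := by
  induction w with
  | nil => simp
  | cons l w ih => rw [scaleWord_cons, List.length_append, List.length_replicate, ih, List.length_cons]; ring

omit [NormedRing 𝔸] [NormOneClass 𝔸] [NormedAlgebra ℂ 𝔸] [CompleteSpace 𝔸] in
/-- displacement of a repeated letter. [cite: Balaban1985Averaging, (9) p.18, bookkeeping] -/
theorem disp_replicate (n : ℕ) (l : Letter D) : disp (List.replicate n l) = (n : ℤ) • l.vec := by
  induction n with
  | zero => simp
  | succ n ih => rw [List.replicate_succ, disp_cons, ih, Nat.cast_succ, add_smul, one_smul, add_comm]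

omit [NormedRing 𝔸] [NormOneClass 𝔸] [NormedAlgebra ℂ 𝔸] [CompleteSpace 𝔸] in
/-- the scaled contour has the scaled displacement. [cite: Balaban1985Averaging, (43) p.24, bookkeeping] -/
theorem disp_scaleWord (n : ℕ) (w : List (Letter D)) : disp (scaleWord n w) = (n : ℤ) • disp w := by
  induction w with
  | nil => simp
  | cons l w ih => rw [scaleWord_cons, disp_append, disp_replicate, ih, disp_cons, smul_add]

omit [NormOneClass 𝔸] [NormedAlgebra ℂ 𝔸] [CompleteSpace 𝔸] in
/-- products of contractions: `‖ab − a′b′‖ ≤ ‖a − a′‖ + ‖b − b′‖` for `‖a′‖, ‖b‖ ≤ 1`. [cite: Balaban1985Averaging, (19) p.21 («|u| ≤ 1»), bookkeeping] -/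
theorem norm_mul_sub_mul_le {a a' b b' : 𝔸} (ha' : ‖a'‖ ≤ 1) (hb : ‖b‖ ≤ 1) : ‖a * b - a' * b'‖ ≤ ‖a - a'‖ + ‖b - b'‖ := by
  have h : a * b - a' * b' = (a - a') * b + a' * (b - b') := by noncomm_ring
  rw [h]
  refine (norm_add_le _ _).trans (add_le_add ?_ ?_)
  · exact (norm_mul_le _ _).trans (by nlinarith [norm_nonneg (a - a'), norm_nonneg b])
  · exact (norm_mul_le _ _).trans (by nlinarith [norm_nonneg (b - b'), norm_nonneg a'])

omit [NormedAlgebra ℂ 𝔸] [CompleteSpace 𝔸] in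
/-- inverses of contractions: `‖u⁻¹ − v⁻¹‖ ≤ ‖u − v‖` in `{|u| ≤ 1, |u⁻¹| ≤ 1}`. [cite: Balaban1985Averaging, (19) p.21, (9) p.18 («U(−b) = U(b)⁻¹»), bookkeeping] -/
theorem norm_inv_sub_inv_le {u v : 𝔸ˣ} (hu : u ∈ U1 𝔸) (hv : v ∈ U1 𝔸) : ‖((u⁻¹ : 𝔸ˣ) : 𝔸) - ((v⁻¹ : 𝔸ˣ) : 𝔸)‖ ≤ ‖(u : 𝔸) - v‖ := by
  have h : ((u⁻¹ : 𝔸ˣ) : 𝔸) - ((v⁻¹ : 𝔸ˣ) : 𝔸) = ((u⁻¹ : 𝔸ˣ) : 𝔸) * ((v : 𝔸) - u) * ((v⁻¹ : 𝔸ˣ) : 𝔸) := by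
    rw [mul_sub, sub_mul, Units.mul_inv_cancel_right, Units.inv_mul, one_mul]
  rw [h]
  calc _ ≤ ‖((u⁻¹ : 𝔸ˣ) : 𝔸)‖ * ‖(v : 𝔸) - u‖ * ‖((v⁻¹ : 𝔸ˣ) : 𝔸)‖ := norm_mul₃_le
    _ ≤ 1 * ‖(v : 𝔸) - u‖ * 1 := by
        refine mul_le_mul (mul_le_mul_of_nonneg_right (mem_U1.1 hu).2 (norm_nonneg _)) (mem_U1.1 hv).2 (norm_nonneg _) ?_
        exact mul_nonneg zero_le_one (norm_nonneg _)
    _ = ‖(u : 𝔸) - v‖ := by rw [one_mul, mul_one, norm_sub_rev]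

omit [NormedAlgebra ℂ 𝔸] [CompleteSpace 𝔸] in
/-- ONE LETTER of the comparison: if every bond of `W` is within `ε` of the straight `n`-step transporter of `V`, so is every traversed letter (forward:
the hypothesis; backward: inverses of contractions). [cite: Balaban1985Averaging, (9) p.18, bookkeeping] -/
theorem stepHol_scaleWord_approx {W V : LSite D → Fin D → 𝔸ˣ} (hW : ∀ x κ, W x κ ∈ U1 𝔸) (hV : ∀ x κ, V x κ ∈ U1 𝔸) (n : ℕ) {ε : ℝ}
    (hε : ∀ y κ, ‖(W y κ : 𝔸) - ((hol V ((n : ℤ) • y) (seg κ (n : ℤ)) : 𝔸ˣ) : 𝔸)‖ ≤ ε) (x : LSite D) (l : Letter D) :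
    ‖((stepHol W x l : 𝔸ˣ) : 𝔸) - ((hol V ((n : ℤ) • x) (List.replicate n l) : 𝔸ˣ) : 𝔸)‖ ≤ ε := by
  obtain ⟨κ, b⟩ := l
  cases b
  · -- backward letter: both sides are inverses
    have hrev : List.replicate n ((κ, false) : Letter D) = revWord (seg κ (n : ℤ)) := by
      rw [seg_natCast, revWord_replicate]; rfl
    have hbase : (n : ℤ) • x = (n : ℤ) • (x - e κ) + disp (seg κ (n : ℤ)) := by rw [disp_seg, smul_sub, sub_add_cancel]
    rw [stepHol_false, hrev, hol_revWord' V ((n : ℤ) • x) (seg κ (n : ℤ)) hbase]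
    exact (norm_inv_sub_inv_le (hW _ _) (hol_mem hV _ _)).trans (hε (x - e κ) κ)
  · rw [stepHol_true, ← seg_natCast]
    exact hε x κ

omit [NormedAlgebra ℂ 𝔸] [CompleteSpace 𝔸] in
/-- ★ **THE TELESCOPING COMPARISON**: if every bond of `W` is within `ε` of the straight `n`-step transporter of `V` (read from `n·y`), then along every
contour `Γ`, `‖W(Γ) − V(scaleWord n Γ)‖ ≤ |Γ|·ε` (fields with values in `{|u| ≤ 1, |u⁻¹| ≤ 1}`). [cite: Balaban1985Averaging, (9) p.18, (19) p.21, p.25 («|V₀(Γ_{c,x}) − 1| < |Γ_{c,x}|dLα₀»)] -/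
theorem hol_scaleWord_approx {W V : LSite D → Fin D → 𝔸ˣ} (hW : ∀ x κ, W x κ ∈ U1 𝔸) (hV : ∀ x κ, V x κ ∈ U1 𝔸) (n : ℕ) {ε : ℝ}
    (hε : ∀ y κ, ‖(W y κ : 𝔸) - ((hol V ((n : ℤ) • y) (seg κ (n : ℤ)) : 𝔸ˣ) : 𝔸)‖ ≤ ε) :
    ∀ (x : LSite D) (w : List (Letter D)),
      ‖((hol W x w : 𝔸ˣ) : 𝔸) - ((hol V ((n : ℤ) • x) (scaleWord n w) : 𝔸ˣ) : 𝔸)‖ ≤ w.length * ε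
  | x, [] => by simp
  | x, l :: w => by
      have hb : (n : ℤ) • x + disp (List.replicate n l) = (n : ℤ) • (x + l.vec) := by rw [disp_replicate, smul_add]
      rw [hol_cons, scaleWord_cons, hol_append, hb, Units.val_mul, Units.val_mul, List.length_cons, Nat.cast_succ, add_mul, one_mul,
        add_comm ((w.length : ℝ) * ε)]
      refine (norm_mul_sub_mul_le (mem_U1.1 (hol_mem hV _ _)).1 (mem_U1.1 (hol_mem hW _ _)).1).trans (add_le_add ?_ ?_)
      · exact stepHol_scaleWord_approx hW hV n hε x l
      · exact hol_scaleWord_approx hW hV n hε (x + l.vec) w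

end Words

/-! ## §2 One average: `V̄_c` is close to the straight contour `V(Γ_c)` -/

section OneAverage

omit [NormedAlgebra ℂ 𝔸] [CompleteSpace 𝔸] in
/-- a global plaquette bound is a plaquette bound on every box. [cite: Balaban1985Averaging, (44) p.24, bookkeeping] -/
theorem plaqSmall_of_pdev {V : LSite D → Fin D → 𝔸ˣ} (hV : ∀ x κ, V x κ ∈ U1 𝔸) {a : ℝ} (ha : pdev V ≤ a) (lo hi : LSite D) :
    B8Lemma1NonAbelian.PlaqSmall V lo hi a := fun x κ μ _ _ _ => (le_pdev hV x κ μ).trans ha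

/-- ★ **ONE AVERAGE IS CLOSE TO THE STRAIGHT CONTOUR**: `‖V̄_c − V(Γ_c)‖ ≤ e^{2ω} − 1`, `ω = L·a·(d−1)(L−1)`, whenever `pdev V ≤ a` and `ω ≤ ½`
(`V̄_c = e^{X_c}V(Γ_c)` with `|X_c| ≤ 2ω`). [cite: Balaban1985Averaging, (42) p.23, p.25] -/
theorem norm_bavg_sub_hol_seg_le (hD : 1 ≤ D) (L : ℕ) (hL : 1 ≤ L) {V : LSite D → Fin D → 𝔸ˣ} (hV : ∀ x κ, V x κ ∈ U1 𝔸) {a : ℝ} (ha0 : 0 ≤ a)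
    (ha : pdev V ≤ a) (hω : omegaC D L a ≤ 1 / 2) (q : LSite D) (κ : Fin D) :
    ‖(bavg L V q κ : 𝔸) - ((hol V q (seg κ L) : 𝔸ˣ) : 𝔸)‖ ≤ Real.exp (2 * omegaC D L a) - 1 := by
  have hX := B8Lemma1NonAbelian.norm_Xavg_le L hL V hV (plaqSmall_of_pdev hV ha q (q + pairTop L κ)) ha0 q κ le_rfl le_rfl hω
  have h : (bavg L V q κ : 𝔸) - ((hol V q (seg κ L) : 𝔸ˣ) : 𝔸) = (exp (Xavg L V q κ) - 1) * ((hol V q (seg κ L) : 𝔸ˣ) : 𝔸) := by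
    rw [sub_mul, one_mul]
    rfl
  rw [h]
  calc _ ≤ ‖exp (Xavg L V q κ) - 1‖ * ‖((hol V q (seg κ L) : 𝔸ˣ) : 𝔸)‖ := norm_mul_le _ _
    _ ≤ (Real.exp (2 * omegaC D L a) - 1) * 1 :=
        mul_le_mul (B7Transfer.norm_exp_sub_one_le_of_le _ hX) (mem_U1.1 (hol_mem hV _ _)).1 (norm_nonneg _)
          (by linarith [Real.add_one_le_exp (2 * omegaC D L a), B8Lemma1NonAbelian.omegaC_nonneg hL hD ha0])
    _ = _ := mul_one _

end OneAverage

/-! ## §3 All levels on the class (52): `Ū^j` is close to the straight fine transporters, uniformly in `j ≤ k` -/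

section AllLevels

omit [NormedRing 𝔸] [NormOneClass 𝔸] [NormedAlgebra ℂ 𝔸] [CompleteSpace 𝔸] in
/-- the scaled straight segment: `scaleWord n (seg κ m) = seg κ (m·n)` (naturals). [cite: Balaban1985Averaging, (43) p.24, bookkeeping] -/
theorem scaleWord_seg_natCast (n m : ℕ) (κ : Fin D) : scaleWord n (seg κ (m : ℤ)) = seg κ ((m * n : ℕ) : ℤ) := by
  rw [seg_natCast, scaleWord_replicate, seg_natCast]

omit [NormedRing 𝔸] [NormOneClass 𝔸] [NormedAlgebra ℂ 𝔸] [CompleteSpace 𝔸] in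
/-- Prop. 1's smallness `2α₀ ≤ c₂′(d, L)` gives `8·D·L²·α₀ ≤ 1`. [cite: Balaban1985Averaging, (51) p.26, bookkeeping] -/
theorem eight_mul_le_one_of_c2' {L : ℕ} (hL : 1 ≤ L) {α₀ : ℝ} (hα : 0 ≤ α₀) (hα2 : 2 * α₀ ≤ c2' D L) :
    8 * (D : ℝ) * (L : ℝ) ^ 2 * α₀ ≤ 1 := by
  have h := hα2
  have hL0 : (0 : ℝ) < L := by exact_mod_cast hL
  unfold c2' at h
  rw [le_div_iff₀ (by positivity)] at h
  have h0 : (0 : ℝ) ≤ (L : ℝ) ^ 2 * α₀ := by positivity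
  nlinarith

/-- ★★★ **THE AVERAGED BONDS ARE CLOSE TO THE STRAIGHT FINE TRANSPORTERS, ALL LEVELS**: for `G` averaging-closed, a `G`-valued `V` on the class (52)
(`pdev V < α₀(L^k)⁻²`) with Prop. 2's smallness, and every `j ≤ k`:
`‖Ū^j(x, x + e_κ) − V(Γ)‖ ≤ 16·D·α₀·(Lʲ/L^k)²`, `Γ` the straight fine contour of `Lʲ` bonds from `Lʲx` in direction `κ`.  Proof = induction on `j`:
one average (§2, with (54) `pdev Ū^j < 2α₀(Lʲ/L^k)²` from `prop2_explicit_lt_two` AT LEVEL `j`) + the telescoping comparison (§1) along `Γ_c`;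
the constants close because `8L² + 16L ≤ 16L²` for `L ≥ 2`. [cite: Balaban1985Averaging, (42) p.23, p.25, Prop. 2 (52)–(54) p.26] -/
theorem avgIter_straight (hD : 1 ≤ D) (L : ℕ) (hL : 2 ≤ L) {G : Subgroup 𝔸ˣ} (hG : AvgClosed D L G) (k : ℕ) {V : LSite D → Fin D → 𝔸ˣ}
    (hV : ∀ x κ, V x κ ∈ G) {α₀ : ℝ} (hα : 0 < α₀) (hα3 : C0 D * α₀ ≤ 1 / 3) (hα2 : 2 * α₀ ≤ c2' D L)
    (h52 : pdev V < α₀ * (((L : ℝ) ^ k)⁻¹) ^ 2) :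
    ∀ j ≤ k, ∀ (x : LSite D) (κ : Fin D),
      ‖(avgIter L V j x κ : 𝔸) - ((hol V (((L ^ j : ℕ) : ℤ) • x) (seg κ ((L ^ j : ℕ) : ℤ)) : 𝔸ˣ) : 𝔸)‖ ≤
        16 * D * α₀ * (((L : ℝ) ^ j) ^ 2 * (((L : ℝ) ^ k)⁻¹) ^ 2) := by
  have hL1 : 1 ≤ L := le_trans (by norm_num) hL
  have hLr : (2 : ℝ) ≤ L := by exact_mod_cast hL
  have hGU : G ≤ U1 𝔸 := hG.le_U1
  have hVU : ∀ x κ, V x κ ∈ U1 𝔸 := fun x κ => hGU (hV x κ)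
  have hω8 := eight_mul_le_one_of_c2' (D := D) hL1 hα.le hα2
  have hLk : 0 < (L : ℝ) ^ k := by positivity
  intro j
  induction j with
  | zero =>
      intro _ x κ
      rw [avgIter_zero, pow_zero, seg_natCast, Nat.cast_one, one_smul, List.replicate_one, hol_cons, hol_nil, mul_one, stepHol_true, sub_self,
        norm_zero]
      positivity
  | succ j ih =>
      intro hjk x κ
      have hj : j ≤ k := (Nat.le_succ j).trans hjk
      set r : ℝ := ((L : ℝ) ^ j) ^ 2 * (((L : ℝ) ^ k)⁻¹) ^ 2 with hr
      have hLj : 0 < (L : ℝ) ^ j := by positivity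
      have hr0 : 0 < r := by positivity
      have hjk' : (L : ℝ) ^ j ≤ (L : ℝ) ^ k := pow_le_pow_right₀ (by linarith) hj
      have hr1 : r ≤ 1 := by
        have h1 : (L : ℝ) ^ j * ((L : ℝ) ^ k)⁻¹ ≤ 1 := by rw [mul_inv_le_iff₀ hLk, one_mul]; exact hjk'
        have h0 : 0 ≤ (L : ℝ) ^ j * ((L : ℝ) ^ k)⁻¹ := by positivity
        have : r = ((L : ℝ) ^ j * ((L : ℝ) ^ k)⁻¹) ^ 2 := by rw [hr]; ring
        rw [this]; nlinarith
      -- Prop. 2 at level `j`, smallness parameter `α₀·r`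
      have hα' : 0 < α₀ * r := mul_pos hα hr0
      have hα'le : α₀ * r ≤ α₀ := mul_le_of_le_one_right hα.le hr1
      have h52' : pdev V < α₀ * r * (((L : ℝ) ^ j)⁻¹) ^ 2 := by
        have : α₀ * r * (((L : ℝ) ^ j)⁻¹) ^ 2 = α₀ * (((L : ℝ) ^ k)⁻¹) ^ 2 := by rw [hr]; field_simp
        rw [this]; exact h52
      have hα3' : C0 D * (α₀ * r) ≤ 1 / 3 := (mul_le_mul_of_nonneg_left hα'le (C0_pos D).le).trans hα3
      have hα2' : 2 * (α₀ * r) ≤ c2' D L := by linarith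
      have hpd : pdev (avgIter L V j) < 2 * (α₀ * r) := prop2_explicit_lt_two L hL hG j V hV hα' hα3' hα2' h52'
      have hWj : ∀ x κ, avgIter L V j x κ ∈ U1 𝔸 := fun x κ => hGU (avgIter_mem L hL hG j V hV hα' hα3' hα2' h52' j le_rfl x κ)
      -- one average at level `j`
      have hD1 : (1 : ℝ) ≤ D := by exact_mod_cast hD
      have hωle : omegaC D L (2 * (α₀ * r)) ≤ 2 * D * (L : ℝ) ^ 2 * (α₀ * r) := by
        unfold omegaC
        have h1 : ((D : ℝ) - 1) * ((L : ℝ) - 1) ≤ D * L := by nlinarith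
        have h0 : 0 ≤ (L : ℝ) * (2 * (α₀ * r)) := by positivity
        nlinarith
      have hω4 : 2 * D * (L : ℝ) ^ 2 * (α₀ * r) ≤ 1 / 4 := by
        have : 2 * D * (L : ℝ) ^ 2 * (α₀ * r) ≤ 2 * D * (L : ℝ) ^ 2 * α₀ := by
          have h0 : 0 ≤ 2 * (D : ℝ) * (L : ℝ) ^ 2 := by positivity
          nlinarith
        linarith
      have hω : omegaC D L (2 * (α₀ * r)) ≤ 1 / 2 := by linarith
      have hω0 : 0 ≤ omegaC D L (2 * (α₀ * r)) := B8Lemma1NonAbelian.omegaC_nonneg hL1 hD (by positivity)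
      have h1 := norm_bavg_sub_hol_seg_le hD L hL1 hWj (by positivity) hpd.le hω ((L : ℤ) • x) κ
      have h1' : Real.exp (2 * omegaC D L (2 * (α₀ * r))) - 1 ≤ 8 * D * (L : ℝ) ^ 2 * (α₀ * r) := by
        have he := Real.abs_exp_sub_one_le (x := 2 * omegaC D L (2 * (α₀ * r))) (by rw [abs_of_nonneg (by positivity)]; linarith)
        rw [abs_of_nonneg (by positivity : (0 : ℝ) ≤ 2 * omegaC D L (2 * (α₀ * r)))] at he
        linarith [le_abs_self (Real.exp (2 * omegaC D L (2 * (α₀ * r))) - 1)]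
      -- the telescoping comparison at level `j` along `Γ_c`
      have h2 := hol_scaleWord_approx hWj hVU (L ^ j) (ε := 16 * D * α₀ * r) (fun y κ' => ih hj y κ') ((L : ℤ) • x) (seg κ (L : ℤ))
      have hlen : ((seg κ (L : ℤ)).length : ℝ) = L := by rw [seg_natCast, List.length_replicate]
      have hbase : ((L ^ j : ℕ) : ℤ) • ((L : ℤ) • x) = ((L ^ (j + 1) : ℕ) : ℤ) • x := by rw [smul_smul, pow_succ, Nat.cast_mul]
      rw [hlen, scaleWord_seg_natCast, ← pow_succ', hbase] at h2
      -- assemble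
      have hstep : (avgIter L V (j + 1) x κ : 𝔸) = bavg L (avgIter L V j) ((L : ℤ) • x) κ := rfl
      rw [hstep]
      calc _ ≤ ‖(bavg L (avgIter L V j) ((L : ℤ) • x) κ : 𝔸) - ((hol (avgIter L V j) ((L : ℤ) • x) (seg κ (L : ℤ)) : 𝔸ˣ) : 𝔸)‖ +
            ‖((hol (avgIter L V j) ((L : ℤ) • x) (seg κ (L : ℤ)) : 𝔸ˣ) : 𝔸) -
              ((hol V (((L ^ (j + 1) : ℕ) : ℤ) • x) (seg κ ((L ^ (j + 1) : ℕ) : ℤ)) : 𝔸ˣ) : 𝔸)‖ := norm_sub_le_norm_sub_add_norm_sub _ _ _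
        _ ≤ 8 * D * (L : ℝ) ^ 2 * (α₀ * r) + L * (16 * D * α₀ * r) := add_le_add (h1.trans h1') h2
        _ ≤ 16 * D * α₀ * (((L : ℝ) ^ (j + 1)) ^ 2 * (((L : ℝ) ^ k)⁻¹) ^ 2) := by
            have hr' : ((L : ℝ) ^ (j + 1)) ^ 2 * (((L : ℝ) ^ k)⁻¹) ^ 2 = (L : ℝ) ^ 2 * r := by rw [hr]; ring
            rw [hr']
            have h0 : 0 ≤ (D : ℝ) * α₀ * r := by positivity
            nlinarith

end AllLevels

end Literature.MathematicalPhysics.QuantumFieldTheory.Balaban1983to89.B9B8AveragedBondsStraight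

end
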